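import Summits.BirchSwinnertonDyer.Rank2Observatory.ZywinaFamilyReduction
import HarnessLib

/-!
# Zywina's family, file 3 of 4: admissibility of `2P₁`, `2P₂`, `2(P₁ + P₂)` at `p ∣ n`, `p ≥ 5`

See `ZywinaFamilyPoints` for the statement of THEOREM R* (cell bsd-rank2) and the plan. Here: for a
prime `p ≥ 5` dividing `n`, the doubles `2P₁`, `2P₂`, `2(P₁+P₂)` are ADMISSIBLE at `p`
(`WeierstrassCurve.IsAdmissible`: non-torsion, in `E₁(ℚ_p)`, in `E₀` at every prime) with
`‖x‖_p⁻¹ = ‖n‖_p²`; `2(P₁+P₂) = 2P₁ + 2P₂` is handled through the subgroup `E₀(ℓ)`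
(`nonsingularReductionSubgroupAt`). B1 honesty: height algebra on a rank-2 family; nothing here
reads the analytic rank.
-/

noncomputable section

open scoped Classical
open Literature.NumberTheory.EllipticCurves Literature.NumberTheory.EllipticCurves.Zywina2025
open WeierstrassCurve

namespace Summit.BirchSwinnertonDyer.Rank2Observatory.ZywinaFamily

/-! ### Admissibility of `2P₁`, `2P₂`, `2(P₁ + P₂)` at a prime `p ≥ 5` dividing `n` -/

section Admissible

variable {m n : ℕ} {p : ℕ} [Fact p.Prime]

/-- `p ∣ n`, `p ≥ 5` ⇒ `p ∤ m` (else `p = m ∣ n`). -/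
theorem not_p_dvd_m (h : ZywinaAdmissible m n) (hpn : p ∣ n) : ¬ p ∣ m := by
  intro hpm
  have := (Nat.prime_dvd_prime_iff_eq (Fact.out : p.Prime) (adm_m_prime h)).mp hpm
  subst this
  exact (adm_not_m_dvd_n h) hpn

/-- `p ∣ n` ⇒ `p` is coprime to `m + 28n²`, `m² + 41mn² + 76n⁴`, `m + 13n²`. -/
theorem coprime_p_α (h : ZywinaAdmissible m n) (hpn : p ∣ n) :
    p.Coprime (m + 28 * n ^ 2) ∧ p.Coprime (m ^ 2 + 41 * m * n ^ 2 + 76 * n ^ 4) ∧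
      p.Coprime (m + 13 * n ^ 2) := by
  have hp : p.Prime := Fact.out
  have hpm := not_p_dvd_m h hpn
  have hn2 : p ∣ n ^ 2 := dvd_pow hpn two_ne_zero
  refine ⟨(Nat.Prime.coprime_iff_not_dvd hp).mpr fun hd => hpm ?_,
    (Nat.Prime.coprime_iff_not_dvd hp).mpr fun hd => hpm ?_,
    (Nat.Prime.coprime_iff_not_dvd hp).mpr fun hd => hpm ?_⟩
  · exact (Nat.dvd_add_left (dvd_mul_of_dvd_right hn2 28)).mp hd
  · have h1 : p ∣ 41 * m * n ^ 2 + 76 * n ^ 4 :=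
      dvd_add (dvd_mul_of_dvd_right hn2 _) (dvd_mul_of_dvd_right (dvd_pow hpn (by norm_num)) _)
    have h2 : p ∣ m ^ 2 := (Nat.dvd_add_left h1).mp (by simpa [add_assoc] using hd)
    exact hp.dvd_of_dvd_pow h2
  · exact (Nat.dvd_add_left (dvd_mul_of_dvd_right hn2 13)).mp hd

/-- **`2P₁` is admissible at `p`** (`p ≥ 5` prime, `p ∣ n`), with `‖x(2P₁)‖_p⁻¹ = ‖n‖_p²`. -/
theorem isAdmissible_two_nsmul_P₁ (h : ZywinaAdmissible m n) (hp : 5 ≤ p) (hpn : p ∣ n) {y' : ℚ}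
    (h' : (zywinaCurve m n).toAffine.Nonsingular
      ((((m + 28 * n ^ 2 : ℕ) : ℚ) ^ 2) / (((4 * n : ℕ) : ℚ) ^ 2)) y') :
    (zywinaCurve m n).IsAdmissible p (.some _ _ h') ∧
      ‖(((((m + 28 * n ^ 2 : ℕ) : ℚ) ^ 2) / (((4 * n : ℕ) : ℚ) ^ 2) : ℚ) : ℚ_[p])‖⁻¹ =
        ‖(n : ℚ_[p])‖ ^ 2 := by
  haveI := isCharNeTwoNF_zywinaCurve m n
  haveI := isIntegral_zywinaCurve m n
  have hx := one_lt_norm_sq_div_sq (ℓ := p) (coprime_α₁ h) (by have := (adm_n_pos h); omega)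
    (dvd_mul_of_dvd_right hpn 4)
  refine ⟨isAdmissible_of_one_lt_norm (by omega) h' hx
    fun ℓ hℓ => hasNonsingularReductionAt_two_nsmul_P₁ h h' hℓ, ?_⟩
  rw [inv_norm_sq_div_sq (coprime_p_α h hpn).1]
  push_cast
  rw [norm_mul, mul_pow, show (4 : ℚ_[p]) = ((4 : ℕ) : ℚ_[p]) by norm_cast,
    Padic.norm_natCast_eq_one_iff.mpr, one_pow, one_mul]
  rw [show (4 : ℕ) = 2 ^ 2 by norm_num]
  exact Nat.Coprime.pow_right 2 ((Nat.coprime_primes Fact.out Nat.prime_two).mpr (by omega))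

/-- **`2P₂` is admissible at `p`** (`p ≥ 5` prime, `p ∣ n`), with `‖x(2P₂)‖_p⁻¹ = ‖n‖_p²`. -/
theorem isAdmissible_two_nsmul_P₂ (h : ZywinaAdmissible m n) (hp : 5 ≤ p) (hpn : p ∣ n) {y' : ℚ}
    (h' : (zywinaCurve m n).toAffine.Nonsingular
      ((((m ^ 2 + 41 * m * n ^ 2 + 76 * n ^ 4 : ℕ) : ℚ) ^ 2) /
        ((6 * (n : ℚ) * ((m : ℚ) - 2 * (n : ℚ) ^ 2)) ^ 2)) y') :
    (zywinaCurve m n).IsAdmissible p (.some _ _ h') ∧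
      ‖(((((m ^ 2 + 41 * m * n ^ 2 + 76 * n ^ 4 : ℕ) : ℚ) ^ 2) /
        ((6 * (n : ℚ) * ((m : ℚ) - 2 * (n : ℚ) ^ 2)) ^ 2) : ℚ) : ℚ_[p])‖⁻¹ = ‖(n : ℚ_[p])‖ ^ 2 := by
  haveI := isCharNeTwoNF_zywinaCurve m n
  haveI := isIntegral_zywinaCurve m n
  have hP : p.Prime := Fact.out
  have hxN : ((((m ^ 2 + 41 * m * n ^ 2 + 76 * n ^ 4 : ℕ) : ℚ) ^ 2) /
        ((6 * (n : ℚ) * ((m : ℚ) - 2 * (n : ℚ) ^ 2)) ^ 2)) =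
      (((m ^ 2 + 41 * m * n ^ 2 + 76 * n ^ 4 : ℕ) : ℚ) ^ 2 /
        (((6 * n * ((m : ℤ) - 2 * (n : ℤ) ^ 2).natAbs : ℕ) : ℚ) ^ 2)) := by
    rw [den₂_sq_eq]
  have hx := one_lt_norm_sq_div_sq (ℓ := p) (coprime_α₂ h)
    (by have := (adm_n_pos h); have := tAbs_pos h; positivity)
    (dvd_mul_of_dvd_left (dvd_mul_of_dvd_right hpn 6) (((m : ℤ) - 2 * (n : ℤ) ^ 2).natAbs))
  rw [← hxN] at hx
  refine ⟨isAdmissible_of_one_lt_norm (by omega) h' hx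
    fun ℓ hℓ => hasNonsingularReductionAt_two_nsmul_P₂ h h' hℓ, ?_⟩
  rw [hxN, inv_norm_sq_div_sq (coprime_p_α h hpn).2.1]
  -- `‖6 n t‖_p = ‖n‖_p`: `p ∤ 6`, `p ∤ t` (as `p ∣ n`, `p ∤ m`)
  have h6 : ‖((6 : ℕ) : ℚ_[p])‖ = 1 := by
    rw [Padic.norm_natCast_eq_one_iff, show (6 : ℕ) = 2 * 3 by norm_num]
    exact Nat.Coprime.mul_right ((Nat.coprime_primes hP Nat.prime_two).mpr (by omega))
      ((Nat.coprime_primes hP Nat.prime_three).mpr (by omega))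
  have ht : ‖((((m : ℤ) - 2 * (n : ℤ) ^ 2).natAbs : ℕ) : ℚ_[p])‖ = 1 := by
    rw [Padic.norm_natCast_eq_one_iff, Nat.Prime.coprime_iff_not_dvd hP]
    intro hdvd
    have h1 : (p : ℤ) ∣ (m : ℤ) - 2 * (n : ℤ) ^ 2 := by
      have := Int.natCast_dvd_natCast.mpr hdvd
      simpa using this
    have h2 : (p : ℤ) ∣ 2 * (n : ℤ) ^ 2 :=
      dvd_mul_of_dvd_right (dvd_pow (Int.natCast_dvd_natCast.mpr hpn) two_ne_zero) 2
    have h3 : (p : ℤ) ∣ (m : ℤ) := by simpa using dvd_add h1 h2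
    exact not_p_dvd_m h hpn (Int.natCast_dvd_natCast.mp h3)
  push_cast at h6 ht ⊢
  rw [norm_mul, norm_mul, h6, ht, one_mul, mul_one]

/-- **`2(P₁ + P₂)` is admissible at `p`** (`p ≥ 5` prime, `p ∣ n`) — by the subgroup property of
`E₀` at every `ℓ` — with `‖x‖_p⁻¹ = ‖n‖_p²`. -/
theorem isAdmissible_two_nsmul_P₁_add_P₂ (h : ZywinaAdmissible m n) (hp : 5 ≤ p) (hpn : p ∣ n)
    {y₁ : ℚ} {h₁ : (zywinaCurve m n).toAffine.Nonsingular
      ((((m + 28 * n ^ 2 : ℕ) : ℚ) ^ 2) / (((4 * n : ℕ) : ℚ) ^ 2)) y₁}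
    (e₁ : 2 • (Affine.Point.some _ _ (nonsingular_P₁ h)) = .some _ y₁ h₁)
    {y₂ : ℚ} {h₂ : (zywinaCurve m n).toAffine.Nonsingular
      ((((m ^ 2 + 41 * m * n ^ 2 + 76 * n ^ 4 : ℕ) : ℚ) ^ 2) /
        ((6 * (n : ℚ) * ((m : ℚ) - 2 * (n : ℚ) ^ 2)) ^ 2)) y₂}
    (e₂ : 2 • (Affine.Point.some _ _ (nonsingular_P₂ h)) = .some _ y₂ h₂)
    {y₃ : ℚ} {h₃ : (zywinaCurve m n).toAffine.Nonsingular
      ((((m + 13 * n ^ 2 : ℕ) : ℚ) ^ 2) / (((2 * n : ℕ) : ℚ) ^ 2)) y₃}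
    (e₃ : 2 • ((Affine.Point.some _ _ (nonsingular_P₁ h)) +
      (Affine.Point.some _ _ (nonsingular_P₂ h))) = .some _ y₃ h₃) :
    (zywinaCurve m n).IsAdmissible p (.some _ y₃ h₃) ∧
      ‖(((((m + 13 * n ^ 2 : ℕ) : ℚ) ^ 2) / (((2 * n : ℕ) : ℚ) ^ 2) : ℚ) : ℚ_[p])‖⁻¹ =
        ‖(n : ℚ_[p])‖ ^ 2 := by
  haveI := isCharNeTwoNF_zywinaCurve m n
  haveI := isIntegral_zywinaCurve m n
  have hP : p.Prime := Fact.out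
  have hx := one_lt_norm_sq_div_sq (ℓ := p) (coprime_α₃ h) (by have := (adm_n_pos h); omega)
    (dvd_mul_of_dvd_right hpn 2)
  have hred : ∀ ℓ : ℕ, ℓ.Prime → (zywinaCurve m n).HasNonsingularReductionAt ℓ
      ((((m + 13 * n ^ 2 : ℕ) : ℚ) ^ 2) / (((2 * n : ℕ) : ℚ) ^ 2)) y₃ := by
    intro ℓ hℓ
    haveI : Fact ℓ.Prime := ⟨hℓ⟩
    have m₁ : (2 • (Affine.Point.some _ _ (nonsingular_P₁ h))) ∈
        (zywinaCurve m n).nonsingularReductionSubgroupAt ℓ := by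
      rw [e₁, mem_nonsingularReductionSubgroupAt_iff]
      exact hasNonsingularReductionAt_two_nsmul_P₁ h h₁ hℓ
    have m₂ : (2 • (Affine.Point.some _ _ (nonsingular_P₂ h))) ∈
        (zywinaCurve m n).nonsingularReductionSubgroupAt ℓ := by
      rw [e₂, mem_nonsingularReductionSubgroupAt_iff]
      exact hasNonsingularReductionAt_two_nsmul_P₂ h h₂ hℓ
    have m₃ := AddSubgroup.add_mem _ m₁ m₂
    rw [← nsmul_add, e₃, mem_nonsingularReductionSubgroupAt_iff] at m₃
    exact m₃
  refine ⟨isAdmissible_of_one_lt_norm (by omega) h₃ hx hred, ?_⟩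
  rw [inv_norm_sq_div_sq (coprime_p_α h hpn).2.2]
  push_cast
  rw [norm_mul, mul_pow, show (2 : ℚ_[p]) = ((2 : ℕ) : ℚ_[p]) by norm_cast,
    Padic.norm_natCast_eq_one_iff.mpr ((Nat.coprime_primes hP Nat.prime_two).mpr (by omega)),
    one_pow, one_mul]

end Admissible
end Summit.BirchSwinnertonDyer.Rank2Observatory.ZywinaFamily
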